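import Literature.Geometry.ComplexHyperbolic.UnitBallLieAlgebraChamberJets          -- ★ p846680 (d2) HEAD: `chamber_forall_norm_iteratedFDeriv_liePhi_bounded` (E-valued; Warner II Thm. 8.4.3.1)
import Literature.Geometry.ComplexHyperbolic.UnitBallLieAlgebraTransfer             -- ★ p846559 (a2-B): `orbital_eq_lieOrbital` (group → algebra at any centre, E-valued, pointwise)
import Literature.NumberTheory.Automorphic.ArchLocalDiagonalSignFrame               -- ★ (A-p18): `exists_continuousMulEquiv_archLocal_U21_torus`, `integral_comp_conj_eq_integral_map_mkU21`, sign frames, `…_of_signs` transports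
import Literature.NumberTheory.Automorphic.ArchLocalDiagonalOppositeSignFrame       -- ★ (A-p18): `exists_continuousMulEquiv_archLocal_of_oppositeSigns`, `ne_zero_of_oppositeSigns`
import Literature.NumberTheory.Automorphic.ArchLocalRelabelTransport                -- ★ (F0P3a-p06): relabelling `G_w(α ∘ σ) ≃ₜ* G_w(α)`, `integral_comp_conj_circleDiagonal_comp_perm_eq_integral_ambient`
import Literature.NumberTheory.Rogawski1990.ArchCentralLimitChamberSmooth           -- ★ `angleChart_ne_of_mem_chamber_ball`; brings ★ `contDiffOn_integral_comp_conj_circleDiagonal_angles_of_blocks` (E-valued, every frame), ★ `contDiff_integral_comp_conj_circleDiagonal_angles_of_posDef`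
import Literature.NumberTheory.Automorphic.ArchLocalTorusOrbitalContinuity           -- ★ `integrable_comp_conj_circleDiagonal` (regular torus points)
import Literature.NumberTheory.Automorphic.ArchLocalRegularTorusClasses              -- ★ `re_embedding_ne_zero`
import Literature.NumberTheory.Automorphic.ArchLocalRegularOrbitClosed               -- ★ `locallyCompactSpace_archLocal`, `secondCountableTopology_archLocal`
import Literature.NumberTheory.Automorphic.ArchCompactPlaceOrbitalSmooth             -- ★ `compactSpace_archLocal_of_posDef`
import Literature.NumberTheory.Rogawski1990.ArchCentralLimitCornerRegularityHolds   -- ★ p847262 (this lineage): the 8-pattern case split of (A6) `_holds` REUSED here (`complex_pos_of_re_pos_of_im_eq_zero`); brings ★ `abs_apply_le_of_mem_ball_zero`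
import Literature.Geometry.ComplexHyperbolic.UnitBallLieAlgebraHCGenerators          -- ★ `contDiff_rootProduct`
import Literature.Analysis.Calculus.ContDiffCurryCompact                            -- ★ p850802 (CURRY-∞, F0P3a-p02 (g20)): `contDiff_curry_of_contDiff` (compact-parameter currying into `P →ᵇ E`)
import HarnessLib

/-!
# HARISH-CHANDRA'S JET BOUNDS FOR THE `π`-NORMALISED TORUS ORBITAL INTEGRAL OF `U(σ_w diag α)(ℂ)` AT EVERY CENTRAL POINT, EVERY FRAME, BANACH-VALUED TEST FUNCTIONS
# (Warner II Thm. 8.4.3.1 ⟹ §8.5.1; Harish-Chandra 1957 Thm. 1; Varadarajan 1977 I §3 ∕ II §12; Bouaziz 1994 §3.1 (I₁) at central points)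

Topic `NumberTheory/Rogawski1990`; namespace `Literature.NumberTheory.Rogawski1990`.  THEOREMS ONLY (no `def`, no instance, no notation, no axiom, no named fact, no `sorry`).
Cell `pub/hodgecm-mathlib`, crux H413 (`stmt-HodgeConjecture-24833`), F0∕P3c line LH3 (closer stub `stub_N9`, letter L1 clause (I₁)), organ O-L1d «HC-CENTRAL» (B3) of leaf
`F0_P3c_StubN9Direct` v5 — THE ONE-PLACE ENGINE; author F0P3a-p09 (g7) (ROAD A lineage), 2026-09-02.  Count-neutral.

THE MATHEMATICS.  Let `G_w = U(σ_w diag α)(ℂ)` (`archLocal L 3 (diagonal α) w`, any of the eight sign patterns of `re σ_wα_i`, `im σ_wα_i = 0`), `ν` a right-invariant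
Haar measure on `G_w`, `E` a complete real normed space, `Θ : M₃(ℂ) → E` smooth with `k ↦ Θ(↑↑k)` compactly supported on `G_w`, `ζ ∈ S¹` a CENTRAL point and
`F(θ) = π(θ) • ∫_{G_w} Θ(↑↑(g · diag(ζe^{iθ_k}) · g⁻¹)) dν(g)`, `π(θ) = (θ₀−θ₁)(θ₀−θ₂)(θ₁−θ₂)` (Harish-Chandra's `∏_{α>0} α` in the angle chart at the centre, ★ `BallModel.rootProduct`).
THEN for every Weyl chamber `C_σ = {θ_{σ0} < θ_{σ1} < θ_{σ2}}` and every order `n`, `F` is `C^∞` on `C_σ ∩ B(0,¼)` and `‖DⁿF‖` IS BOUNDED THERE — Harish-Chandra's local boundedness of every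
jet of the normalised invariant integral at a central point of the compact Cartan subgroup.
* §1 e-pattern frames (`re σ_wα₀, re σ_wα₁ > 0 > re σ_wα₂`): along ★ A-p18's frame `e : G_w ≃ₜ* U21` (identity on the torus) and ★ (a2-B) `orbital_eq_lieOrbital`, `F = liePhi (ν.map e) f` on
  the closed cube `|θ_k| ≤ ¼` for ONE `f ∈ C_c^∞(M₃(ℂ); E)`, so ★ (d2) `chamber_forall_norm_iteratedFDeriv_liePhi_bounded` (Warner Thm. 8.4.3.1, E-valued) IS the bound.
* §2 transport along torus-fixing frames `u ↦ TuT⁻¹` (★ `ArchLocalDiagonalSignFrame`): same∕opposite sign patterns, `α ↦ −α`; §3 relabelling `α ↦ α ∘ σ′` (★ `ArchLocalRelabelTransport`;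
  `π(θ ∘ σ′) = ±π(θ)`, `θ ↦ θ ∘ σ′` a linear isometry of `ℝ³` permuting the chambers); §4 definite frames (`G_w` compact: `F` is `C^∞` on `ℝ³`).
* §5 HEAD `exists_forall_norm_iteratedFDeriv_rootProduct_smul_orbital_le` at EVERY frame + `contDiffOn_rootProduct_smul_orbital_chamber_ball`; §6 rider: the CLM-uniform form
  `…_comp_clm_le` (`Θ = ℓ ∘ G`, ONE constant scaled by `‖ℓ‖` — the seminorm shape the (I₁) parametric∕`ℓ^∞` readers consume, twin of ★ (ELL-∞-UNIF) §4); §7 rider: the bound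
  UNIFORM IN THE CENTRE `ζ ∈ S¹` `…_le_uniform_centre` (★ (CURRY-∞) `contDiff_curry_of_contDiff`: `Θ(ζ • ·)` is ONE `C^∞` map into `S¹ →ᵇ E`, read through `ev_ζ` by §6).
HONEST LABEL: HC_CM is proved only modulo the 7 printed citations (2 remaining: hLiu418 = `stmt-HodgeConjecture-24832`, h413 = `stmt-HodgeConjecture-24833`) until rung 0 closes;
this is the one-place engine of organ O-L1d, it pays nothing by itself (the (C)-box junction to `orbFamGExt` is a separate brick).

## References
* [WarnerHASSLG2] G. Warner, *Harmonic Analysis on Semi-Simple Lie Groups II*, Grundlehren 189 (1972), §8.4.1, Thm. 8.4.3.1, §8.5.1.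
* [HarishChandra1957DiffOps] Harish-Chandra, *Differential operators on a semisimple Lie algebra*, Amer. J. Math. 79 (1957) 87–120, Thm. 1.
* [Varadarajan1977] V. S. Varadarajan, *Harmonic Analysis on Real Reductive Groups*, LNM 576 (1977), Part I §3, Part II §12.
* [Bouaziz1994IntegralesOrbitales] A. Bouaziz, *Intégrales orbitales sur les groupes de Lie réductifs*, Ann. Sci. ÉNS 27 (1994), §3.1 (I₁) p. 579, Thm. 3.2.1 p. 581.
* [Rogawski1990] J. D. Rogawski, *Automorphic Representations of Unitary Groups in Three Variables*, Ann. of Math. Stud. 123 (1990), §8.2 p. 122, §8.4 p. 126.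
* [HormanderALPDO1] L. Hörmander, *The Analysis of Linear Partial Differential Operators I*, Grundlehren 256 (1983), §1.1 Thm. 1.1.9.
* [PlatonovRapinchuk1994] V. Platonov, A. Rapinchuk, *Algebraic Groups and Number Theory* (1994), §2.3, §3.2 Thm. 3.1.
-/

set_option autoImplicit false

noncomputable section

open MeasureTheory Measure Filter Topology Set Function Metric Complex NumberField NumberField.InfinitePlace Matrix Equiv
open Literature.NumberTheory.Automorphic Literature.NumberTheory.Automorphic.UnitaryGroup
open Literature.Geometry.ComplexHyperbolic Literature.Geometry.ComplexHyperbolic.BallModel Literature.LinearAlgebra.Matrix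
open scoped MatrixGroups Matrix.Norms.Operator ContDiff ComplexOrder BoundedContinuousFunction

namespace Literature.NumberTheory.Rogawski1990

universe u

/-! ## §1 The e-pattern frames: `F = liePhi (ν.map e) f` on the cube, Harish-Chandra's bound -/

section EPattern

variable (L : Type) [Field L] (α : Fin 3 → L) (w : {w : InfinitePlace L // IsComplex w})
variable {E : Type u} [NormedAddCommGroup E] [NormedSpace ℝ E] [CompleteSpace E]

omit [CompleteSpace E] in
/-- **GROUP → ALGEBRA AT THE CENTRE, BANACH-VALUED** (E-valued twin of ★ (f1) `exists_frame_testFunction_orbital_eq_lieOrbital`): at a frame with `re σ_wα₀, re σ_wα₁ > 0 > re σ_wα₂`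
there are `e : G_w ≃ₜ* U(2,1)` (★ A-p18, identity on the torus) and ONE `f ∈ C_c^∞(M₃(ℂ); E)` with
`∫_{G_w} Θ(↑↑(g·diag(ζe^{iθ_k})·g⁻¹)) dν = lieOrbital (ν.map e) f (torusH θ)` whenever `|θ_k| ≤ ¼`. [cite: WarnerHASSLG2, §8.4.1] [cite: Rogawski1990, §8.4 p. 126] -/
theorem exists_frame_testFunction_orbital_eq_lieOrbital_banach (hreal : ∀ i, (w.1.embedding (α i)).im = 0)
    (h0 : 0 < (w.1.embedding (α 0)).re) (h1 : 0 < (w.1.embedding (α 1)).re) (h2 : (w.1.embedding (α 2)).re < 0)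
    [MeasurableSpace (archLocal L 3 (Matrix.diagonal α) w)] [BorelSpace (archLocal L 3 (Matrix.diagonal α) w)]
    (ν : Measure (archLocal L 3 (Matrix.diagonal α) w)) (Θ : Matrix (Fin 3) (Fin 3) ℂ → E) (hΘ : ContDiff ℝ ∞ Θ)
    (hΘc : HasCompactSupport fun k : archLocal L 3 (Matrix.diagonal α) w => Θ ((k : GL (Fin 3) ℂ) : Matrix (Fin 3) (Fin 3) ℂ)) (ζ : Circle) :
    ∃ (e : archLocal L 3 (Matrix.diagonal α) w ≃ₜ* U21) (f : Matrix (Fin 3) (Fin 3) ℂ → E), ContDiff ℝ ∞ f ∧ HasCompactSupport f ∧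
      ∀ θ : Fin 3 → ℝ, (∀ k, |θ k| ≤ 1 / 4) →
        (∫ g, Θ (((g * ⟨circleDiagonal 3 (fun k => ζ * Circle.exp (θ k)), circleDiagonal_mem_archLocal_diagonal L 3 α w _⟩ * g⁻¹ : archLocal L 3 (Matrix.diagonal α) w) : GL (Fin 3) ℂ) : Matrix (Fin 3) (Fin 3) ℂ) ∂ν)
          = lieOrbital (ν.map e) f (torusH θ) := by
  obtain ⟨T, e, -, he, hez⟩ := exists_continuousMulEquiv_archLocal_U21_torus L α w hreal h0 h1 h2
  have hΘT : ContDiff ℝ ∞ (fun M : Matrix (Fin 3) (Fin 3) ℂ => Θ ((T : Matrix (Fin 3) (Fin 3) ℂ) * M * ((T⁻¹ : GL (Fin 3) ℂ) : Matrix (Fin 3) (Fin 3) ℂ))) :=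
    contDiff_comp_conjFrame T hΘ
  have hΘTc : HasCompactSupport (fun u : U21 => Θ ((T : Matrix (Fin 3) (Fin 3) ℂ) * mat u * ((T⁻¹ : GL (Fin 3) ℂ) : Matrix (Fin 3) (Fin 3) ℂ))) :=
    hasCompactSupport_comp_conjFrame L α w T e he hΘc
  obtain ⟨f, hf, hfc, -, hint⟩ := orbital_eq_lieOrbital (fun M : Matrix (Fin 3) (Fin 3) ℂ => Θ ((T : Matrix (Fin 3) (Fin 3) ℂ) * M * ((T⁻¹ : GL (Fin 3) ℂ) : Matrix (Fin 3) (Fin 3) ℂ))) hΘT hΘTc ζ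
  refine ⟨e, f, hf, hfc, fun θ hθ => ?_⟩
  rw [integral_comp_conj_eq_integral_map_mkU21 L α w T e he hez ν Θ (fun k => ζ * Circle.exp (θ k)) (diagonal_circle_preserves _)]
  exact hint (ν.map e) θ hθ

/-- **HARISH-CHANDRA'S BOUND AT AN e-PATTERN FRAME**: for `re σ_wα₀, re σ_wα₁ > 0 > re σ_wα₂`, a right-invariant Haar `ν`, `Θ ∈ C^∞(M₃(ℂ); E)` compactly supported on `G_w`, a centre `ζ`,
a chamber `σ` and an order `n`: `‖Dⁿ(θ ↦ π(θ) • ∫_{G_w} Θ(↑↑(g·diag(ζe^{iθ})·g⁻¹)) dν)‖ ≤ M` on `C_σ ∩ B(0,¼)` (`F = liePhi (ν.map e) f` on `B(0,¼)`, ★ (d2)).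
[cite: WarnerHASSLG2, Thm. 8.4.3.1] [cite: HarishChandra1957DiffOps, Thm. 1] -/
theorem exists_forall_norm_iteratedFDeriv_rootProduct_smul_orbital_le_of_ppm (hreal : ∀ i, (w.1.embedding (α i)).im = 0)
    (h0 : 0 < (w.1.embedding (α 0)).re) (h1 : 0 < (w.1.embedding (α 1)).re) (h2 : (w.1.embedding (α 2)).re < 0)
    [MeasurableSpace (archLocal L 3 (Matrix.diagonal α) w)] [BorelSpace (archLocal L 3 (Matrix.diagonal α) w)]
    (ν : Measure (archLocal L 3 (Matrix.diagonal α) w)) [ν.IsHaarMeasure] [ν.IsMulRightInvariant]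
    (Θ : Matrix (Fin 3) (Fin 3) ℂ → E) (hΘ : ContDiff ℝ ∞ Θ)
    (hΘc : HasCompactSupport fun k : archLocal L 3 (Matrix.diagonal α) w => Θ ((k : GL (Fin 3) ℂ) : Matrix (Fin 3) (Fin 3) ℂ))
    (ζ : Circle) (σ : Equiv.Perm (Fin 3)) (n : ℕ) :
    ∃ M : ℝ, ∀ θ ∈ {θ : Fin 3 → ℝ | θ (σ 0) < θ (σ 1) ∧ θ (σ 1) < θ (σ 2)} ∩ ball (0 : Fin 3 → ℝ) (1 / 4),
      ‖iteratedFDeriv ℝ n (fun θ : Fin 3 → ℝ => (rootProduct θ : ℝ) •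
        ∫ g, Θ (((g * ⟨circleDiagonal 3 (fun k => ζ * Circle.exp (θ k)), circleDiagonal_mem_archLocal_diagonal L 3 α w _⟩ * g⁻¹ : archLocal L 3 (Matrix.diagonal α) w) : GL (Fin 3) ℂ) : Matrix (Fin 3) (Fin 3) ℂ) ∂ν) θ‖ ≤ M := by
  obtain ⟨e, f, hf, hfc, hint⟩ := exists_frame_testFunction_orbital_eq_lieOrbital_banach L α w hreal h0 h1 h2 ν Θ hΘ hΘc ζ
  haveI : (ν.map e).IsHaarMeasure := isHaarMeasure_map_archLocalEquiv L α w e ν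
  haveI : (ν.map e).IsMulRightInvariant := isMulRightInvariant_map_archLocalEquiv L α w e ν
  obtain ⟨M, hM⟩ := chamber_forall_norm_iteratedFDeriv_liePhi_bounded (ν.map e) hf hfc σ n
  refine ⟨M, fun θ hθ => ?_⟩
  -- on the open ball the two functions agree, hence so do their jets
  have hEq : (fun θ : Fin 3 → ℝ => (rootProduct θ : ℝ) •
        ∫ g, Θ (((g * ⟨circleDiagonal 3 (fun k => ζ * Circle.exp (θ k)), circleDiagonal_mem_archLocal_diagonal L 3 α w _⟩ * g⁻¹ : archLocal L 3 (Matrix.diagonal α) w) : GL (Fin 3) ℂ) : Matrix (Fin 3) (Fin 3) ℂ) ∂ν)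
      =ᶠ[𝓝 θ] liePhi (ν.map e) f := by
    filter_upwards [isOpen_ball.mem_nhds hθ.2] with θ' hθ'
    rw [liePhi_def, hint θ' (abs_apply_le_of_mem_ball_zero hθ')]
  rw [(hEq.iteratedFDeriv ℝ n).self_of_nhds]
  exact hM θ hθ

end EPattern

/-! ## §2 Transport along torus-fixing frames `u ↦ T u T⁻¹` (same or opposite sign patterns; `α ↦ −α`) -/

section OfFrame

variable (L : Type) [Field L] (α : Fin 3 → L) (w : {w : InfinitePlace L // IsComplex w})
variable (L₀ : Type) [Field L₀] (α₀ : Fin 3 → L₀) (w₀ : {w : InfinitePlace L₀ // IsComplex w})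
variable {E : Type u} [NormedAddCommGroup E] [NormedSpace ℝ E] [CompleteSpace E]

omit [CompleteSpace E] in
/-- **THE BOUND TRANSPORTS ALONG A TORUS-FIXING FRAME.**  Given `T : GL₃(ℂ)` and `e : U(σ_{w₀} diag α₀)(ℂ) ≃ₜ* U(σ_w diag α)(ℂ)` with `e u = T u T⁻¹` and `e (t₀ z) = t z`
(★ `exists_continuousMulEquiv_archLocal_of_signs` ∕ `…_of_oppositeSigns`), Harish-Chandra's chamber jet bound for ALL data at the source frame gives it for all data at the target:
`Φ^α_Θ(t z) = Φ^{α₀}_{Θ∘Ad T}(t₀ z)` pointwise (★ `integral_comp_conj_eq_integral_map_symm_of_signs`), so the two `π`-normalised torus functions are EQUAL.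
[cite: Rogawski1990, §8.4 p. 126] [cite: WarnerHASSLG2, Thm. 8.4.3.1] -/
theorem forall_norm_iteratedFDeriv_rootProduct_smul_orbital_le_of_frame
    (T : GL (Fin 3) ℂ) (e : archLocal L₀ 3 (Matrix.diagonal α₀) w₀ ≃ₜ* archLocal L 3 (Matrix.diagonal α) w)
    (he : ∀ u : archLocal L₀ 3 (Matrix.diagonal α₀) w₀, ((e u : archLocal L 3 (Matrix.diagonal α) w) : GL (Fin 3) ℂ) = T * (u : GL (Fin 3) ℂ) * T⁻¹)
    (hez : ∀ z : Fin 3 → Circle, e ⟨circleDiagonal 3 z, circleDiagonal_mem_archLocal_diagonal L₀ 3 α₀ w₀ z⟩ = ⟨circleDiagonal 3 z, circleDiagonal_mem_archLocal_diagonal L 3 α w z⟩)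
    (h₀ : ∀ [MeasurableSpace (archLocal L₀ 3 (Matrix.diagonal α₀) w₀)] [BorelSpace (archLocal L₀ 3 (Matrix.diagonal α₀) w₀)]
      (ν₀ : Measure (archLocal L₀ 3 (Matrix.diagonal α₀) w₀)) [ν₀.IsHaarMeasure] [ν₀.IsMulRightInvariant]
      (Θ₀ : Matrix (Fin 3) (Fin 3) ℂ → E), ContDiff ℝ ∞ Θ₀ →
      HasCompactSupport (fun k : archLocal L₀ 3 (Matrix.diagonal α₀) w₀ => Θ₀ ((k : GL (Fin 3) ℂ) : Matrix (Fin 3) (Fin 3) ℂ)) →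
      ∀ (ζ : Circle) (σ : Equiv.Perm (Fin 3)) (n : ℕ),
        ∃ M : ℝ, ∀ θ ∈ {θ : Fin 3 → ℝ | θ (σ 0) < θ (σ 1) ∧ θ (σ 1) < θ (σ 2)} ∩ ball (0 : Fin 3 → ℝ) (1 / 4),
          ‖iteratedFDeriv ℝ n (fun θ : Fin 3 → ℝ => (rootProduct θ : ℝ) •
            ∫ g, Θ₀ (((g * ⟨circleDiagonal 3 (fun k => ζ * Circle.exp (θ k)), circleDiagonal_mem_archLocal_diagonal L₀ 3 α₀ w₀ _⟩ * g⁻¹ : archLocal L₀ 3 (Matrix.diagonal α₀) w₀) : GL (Fin 3) ℂ) : Matrix (Fin 3) (Fin 3) ℂ) ∂ν₀) θ‖ ≤ M)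
    [MeasurableSpace (archLocal L 3 (Matrix.diagonal α) w)] [BorelSpace (archLocal L 3 (Matrix.diagonal α) w)]
    (ν : Measure (archLocal L 3 (Matrix.diagonal α) w)) [ν.IsHaarMeasure] [ν.IsMulRightInvariant]
    (Θ : Matrix (Fin 3) (Fin 3) ℂ → E) (hΘ : ContDiff ℝ ∞ Θ)
    (hΘc : HasCompactSupport fun k : archLocal L 3 (Matrix.diagonal α) w => Θ ((k : GL (Fin 3) ℂ) : Matrix (Fin 3) (Fin 3) ℂ))
    (ζ : Circle) (σ : Equiv.Perm (Fin 3)) (n : ℕ) :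
    ∃ M : ℝ, ∀ θ ∈ {θ : Fin 3 → ℝ | θ (σ 0) < θ (σ 1) ∧ θ (σ 1) < θ (σ 2)} ∩ ball (0 : Fin 3 → ℝ) (1 / 4),
      ‖iteratedFDeriv ℝ n (fun θ : Fin 3 → ℝ => (rootProduct θ : ℝ) •
        ∫ g, Θ (((g * ⟨circleDiagonal 3 (fun k => ζ * Circle.exp (θ k)), circleDiagonal_mem_archLocal_diagonal L 3 α w _⟩ * g⁻¹ : archLocal L 3 (Matrix.diagonal α) w) : GL (Fin 3) ℂ) : Matrix (Fin 3) (Fin 3) ℂ) ∂ν) θ‖ ≤ M := by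
  -- Borel structure and transported Haar measure on the source frame
  haveI : LocallyCompactSpace (archLocal L₀ 3 (Matrix.diagonal α₀) w₀) := locallyCompactSpace_archLocal L₀ 3 (Matrix.diagonal α₀) w₀
  haveI : SecondCountableTopology (archLocal L₀ 3 (Matrix.diagonal α₀) w₀) := secondCountableTopology_archLocal L₀ 3 (Matrix.diagonal α₀) w₀
  letI : MeasurableSpace (archLocal L₀ 3 (Matrix.diagonal α₀) w₀) := borel _
  haveI : BorelSpace (archLocal L₀ 3 (Matrix.diagonal α₀) w₀) := ⟨rfl⟩
  haveI := isHaarMeasure_map_symm_of_signs L α w L₀ α₀ w₀ e ν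
  haveI := isMulRightInvariant_map_symm_of_signs L α w L₀ α₀ w₀ e ν
  obtain ⟨M, hM⟩ := h₀ (ν.map e.symm)
    (fun M : Matrix (Fin 3) (Fin 3) ℂ => Θ ((T : Matrix (Fin 3) (Fin 3) ℂ) * M * ((T⁻¹ : GL (Fin 3) ℂ) : Matrix (Fin 3) (Fin 3) ℂ)))
    (contDiff_comp_conjFrame T hΘ) (hasCompactSupport_comp_conj_of_signs L α w L₀ α₀ w₀ T e he hΘc) ζ σ n
  have hfun : (fun θ : Fin 3 → ℝ => (rootProduct θ : ℝ) •
        ∫ g, Θ (((g * ⟨circleDiagonal 3 (fun k => ζ * Circle.exp (θ k)), circleDiagonal_mem_archLocal_diagonal L 3 α w _⟩ * g⁻¹ : archLocal L 3 (Matrix.diagonal α) w) : GL (Fin 3) ℂ) : Matrix (Fin 3) (Fin 3) ℂ) ∂ν) =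
      (fun θ : Fin 3 → ℝ => (rootProduct θ : ℝ) •
        ∫ u, (fun M : Matrix (Fin 3) (Fin 3) ℂ => Θ ((T : Matrix (Fin 3) (Fin 3) ℂ) * M * ((T⁻¹ : GL (Fin 3) ℂ) : Matrix (Fin 3) (Fin 3) ℂ)))
          (((u * ⟨circleDiagonal 3 (fun k => ζ * Circle.exp (θ k)), circleDiagonal_mem_archLocal_diagonal L₀ 3 α₀ w₀ _⟩ * u⁻¹ : archLocal L₀ 3 (Matrix.diagonal α₀) w₀) : GL (Fin 3) ℂ) : Matrix (Fin 3) (Fin 3) ℂ) ∂(ν.map e.symm)) := by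
    funext θ
    rw [integral_comp_conj_eq_integral_map_symm_of_signs L α w L₀ α₀ w₀ T e he hez ν Θ (fun k => ζ * Circle.exp (θ k))]
  rw [hfun]
  exact ⟨M, hM⟩

omit [CompleteSpace E] in
/-- **OPPOSITE SIGN PATTERNS**: `re σ_w(α_i) · re σ_{w₀}(α₀_i) < 0` for all `i` (`U(σ_w diag α) ≅ U(σ_{w₀} diag α₀)` along a torus-fixing diagonal frame, ★ `exists_continuousMulEquiv_archLocal_of_oppositeSigns`):
the chamber jet bound at `(L₀, α₀, w₀)` for all data gives it at `(L, α, w)`. [cite: Rogawski1990, §8.4 p. 126] [cite: PlatonovRapinchuk1994, §2.3] -/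
theorem forall_norm_iteratedFDeriv_rootProduct_smul_orbital_le_of_oppositeSigns
    (hreal : ∀ i, (w.1.embedding (α i)).im = 0) (hreal₀ : ∀ i, (w₀.1.embedding (α₀ i)).im = 0)
    (hopp : ∀ i, (w.1.embedding (α i)).re * (w₀.1.embedding (α₀ i)).re < 0)
    (h₀ : ∀ [MeasurableSpace (archLocal L₀ 3 (Matrix.diagonal α₀) w₀)] [BorelSpace (archLocal L₀ 3 (Matrix.diagonal α₀) w₀)]
      (ν₀ : Measure (archLocal L₀ 3 (Matrix.diagonal α₀) w₀)) [ν₀.IsHaarMeasure] [ν₀.IsMulRightInvariant]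
      (Θ₀ : Matrix (Fin 3) (Fin 3) ℂ → E), ContDiff ℝ ∞ Θ₀ →
      HasCompactSupport (fun k : archLocal L₀ 3 (Matrix.diagonal α₀) w₀ => Θ₀ ((k : GL (Fin 3) ℂ) : Matrix (Fin 3) (Fin 3) ℂ)) →
      ∀ (ζ : Circle) (σ : Equiv.Perm (Fin 3)) (n : ℕ),
        ∃ M : ℝ, ∀ θ ∈ {θ : Fin 3 → ℝ | θ (σ 0) < θ (σ 1) ∧ θ (σ 1) < θ (σ 2)} ∩ ball (0 : Fin 3 → ℝ) (1 / 4),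
          ‖iteratedFDeriv ℝ n (fun θ : Fin 3 → ℝ => (rootProduct θ : ℝ) •
            ∫ g, Θ₀ (((g * ⟨circleDiagonal 3 (fun k => ζ * Circle.exp (θ k)), circleDiagonal_mem_archLocal_diagonal L₀ 3 α₀ w₀ _⟩ * g⁻¹ : archLocal L₀ 3 (Matrix.diagonal α₀) w₀) : GL (Fin 3) ℂ) : Matrix (Fin 3) (Fin 3) ℂ) ∂ν₀) θ‖ ≤ M)
    [MeasurableSpace (archLocal L 3 (Matrix.diagonal α) w)] [BorelSpace (archLocal L 3 (Matrix.diagonal α) w)]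
    (ν : Measure (archLocal L 3 (Matrix.diagonal α) w)) [ν.IsHaarMeasure] [ν.IsMulRightInvariant]
    (Θ : Matrix (Fin 3) (Fin 3) ℂ → E) (hΘ : ContDiff ℝ ∞ Θ)
    (hΘc : HasCompactSupport fun k : archLocal L 3 (Matrix.diagonal α) w => Θ ((k : GL (Fin 3) ℂ) : Matrix (Fin 3) (Fin 3) ℂ))
    (ζ : Circle) (σ : Equiv.Perm (Fin 3)) (n : ℕ) :
    ∃ M : ℝ, ∀ θ ∈ {θ : Fin 3 → ℝ | θ (σ 0) < θ (σ 1) ∧ θ (σ 1) < θ (σ 2)} ∩ ball (0 : Fin 3 → ℝ) (1 / 4),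
      ‖iteratedFDeriv ℝ n (fun θ : Fin 3 → ℝ => (rootProduct θ : ℝ) •
        ∫ g, Θ (((g * ⟨circleDiagonal 3 (fun k => ζ * Circle.exp (θ k)), circleDiagonal_mem_archLocal_diagonal L 3 α w _⟩ * g⁻¹ : archLocal L 3 (Matrix.diagonal α) w) : GL (Fin 3) ℂ) : Matrix (Fin 3) (Fin 3) ℂ) ∂ν) θ‖ ≤ M := by
  obtain ⟨T, e, he, hez, -⟩ := exists_continuousMulEquiv_archLocal_of_oppositeSigns L α w L₀ α₀ w₀ hreal hreal₀ hopp
  exact forall_norm_iteratedFDeriv_rootProduct_smul_orbital_le_of_frame L α w L₀ α₀ w₀ T e he hez h₀ ν Θ hΘ hΘc ζ σ n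

end OfFrame

/-! ## §3 Relabelling `α ↦ α ∘ σ′`: `π(θ ∘ σ′) = sign σ′ · π(θ)`, and `θ ↦ θ ∘ σ′` is a linear isometry of `ℝ³` permuting the chambers -/

section OfPerm

/-- `π` is ALTERNATING under a transposition of two coordinates. [cite: WarnerHASSLG2, §8.4.1] -/
theorem rootProduct_comp_swap (θ : Fin 3 → ℝ) (a b : Fin 3) (hab : a ≠ b) :
    rootProduct (θ ∘ ⇑(Equiv.swap a b)) = -rootProduct θ := by
  fin_cases a <;> fin_cases b
  all_goals first
    | exact absurd rfl hab
    | (simp only [rootProduct, Function.comp_apply]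
       simp [Equiv.swap_apply_def]
       ring)

/-- `π(θ ∘ σ′) = sign(σ′) · π(θ)` for every `σ′ ∈ S₃`. [cite: WarnerHASSLG2, §8.4.1] -/
theorem rootProduct_comp_perm (θ : Fin 3 → ℝ) (σ' : Equiv.Perm (Fin 3)) :
    rootProduct (θ ∘ ⇑σ') = ((Equiv.Perm.sign σ' : ℤ) : ℝ) * rootProduct θ := by
  induction σ' using Equiv.Perm.swap_induction_on' generalizing θ with
  | one => simp
  | mul_swap f a b hab ih =>
    have hcomp : (θ ∘ ⇑(f * Equiv.swap a b)) = ((θ ∘ ⇑f) ∘ ⇑(Equiv.swap a b)) := by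
      funext k; simp
    rw [hcomp, rootProduct_comp_swap _ a b hab, ih, Equiv.Perm.sign_mul, Equiv.Perm.sign_swap hab]
    push_cast
    ring

/-- The coordinate relabelling `θ ↦ θ ∘ σ′` is a LINEAR ISOMETRY of `ℝ³` (sup norm). [cite: WarnerHASSLG2, §8.4.1] -/
theorem exists_linearIsometryEquiv_comp_perm (σ' : Equiv.Perm (Fin 3)) :
    ∃ Λ : (Fin 3 → ℝ) ≃ₗᵢ[ℝ] (Fin 3 → ℝ), ∀ θ : Fin 3 → ℝ, Λ θ = θ ∘ ⇑σ' := by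
  have hnorm : ∀ θ : Fin 3 → ℝ, ‖θ ∘ ⇑σ'‖ = ‖θ‖ := by
    intro θ
    apply le_antisymm
    · exact (pi_norm_le_iff_of_nonneg (norm_nonneg θ)).2 fun i => norm_le_pi_norm θ (σ' i)
    · refine (pi_norm_le_iff_of_nonneg (norm_nonneg _)).2 fun i => ?_
      have h := norm_le_pi_norm (θ ∘ ⇑σ') (σ'.symm i)
      simpa only [Function.comp_apply, Equiv.apply_symm_apply] using h
  exact ⟨{ LinearEquiv.funCongrLeft ℝ ℝ σ' with norm_map' := hnorm }, fun θ => rfl⟩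

variable (L : Type) [Field L] (α : Fin 3 → L) (w : {w : InfinitePlace L // IsComplex w})
variable {E : Type u} [NormedAddCommGroup E] [NormedSpace ℝ E] [CompleteSpace E]

omit [CompleteSpace E] in
/-- **THE BOUND IS RELABELLING-INVARIANT**: the chamber jet bound for all data at the frame `α ∘ σ′` gives it at `α`.  On `G_w(α)`,
`F^α_Θ(θ) = sign(σ′) • F^{α∘σ′}_{Θ∘Ad M(σ′)}(θ ∘ σ′)` for the transported data `((e_{σ′}⁻¹)_*ν, Θ ∘ Ad M(σ′))` (★ `integral_comp_conj_circleDiagonal_comp_perm_eq_integral_ambient`, `π(θ∘σ′) = ±π(θ)`),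
`θ ↦ θ ∘ σ′` is a linear isometry carrying `C_τ ∩ B(0,¼)` onto `C_{σ′⁻¹τ} ∩ B(0,¼)`, and `‖Dⁿ(F ∘ Λ)(θ)‖ = ‖DⁿF(Λθ)‖` (Mathlib `LinearIsometryEquiv.norm_iteratedFDeriv_comp_right`).
[cite: Rogawski1990, §8.4 p. 126] [cite: WarnerHASSLG2, Thm. 8.4.3.1] -/
theorem forall_norm_iteratedFDeriv_rootProduct_smul_orbital_le_of_perm (σ' : Equiv.Perm (Fin 3))
    (h : ∀ [MeasurableSpace (archLocal L 3 (Matrix.diagonal (α ∘ ⇑σ')) w)] [BorelSpace (archLocal L 3 (Matrix.diagonal (α ∘ ⇑σ')) w)]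
      (ν' : Measure (archLocal L 3 (Matrix.diagonal (α ∘ ⇑σ')) w)) [ν'.IsHaarMeasure] [ν'.IsMulRightInvariant]
      (Θ' : Matrix (Fin 3) (Fin 3) ℂ → E), ContDiff ℝ ∞ Θ' →
      HasCompactSupport (fun k : archLocal L 3 (Matrix.diagonal (α ∘ ⇑σ')) w => Θ' ((k : GL (Fin 3) ℂ) : Matrix (Fin 3) (Fin 3) ℂ)) →
      ∀ (ζ : Circle) (σ : Equiv.Perm (Fin 3)) (n : ℕ),
        ∃ M : ℝ, ∀ θ ∈ {θ : Fin 3 → ℝ | θ (σ 0) < θ (σ 1) ∧ θ (σ 1) < θ (σ 2)} ∩ ball (0 : Fin 3 → ℝ) (1 / 4),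
          ‖iteratedFDeriv ℝ n (fun θ : Fin 3 → ℝ => (rootProduct θ : ℝ) •
            ∫ g, Θ' (((g * ⟨circleDiagonal 3 (fun k => ζ * Circle.exp (θ k)), circleDiagonal_mem_archLocal_diagonal L 3 (α ∘ ⇑σ') w _⟩ * g⁻¹ : archLocal L 3 (Matrix.diagonal (α ∘ ⇑σ')) w) : GL (Fin 3) ℂ) : Matrix (Fin 3) (Fin 3) ℂ) ∂ν') θ‖ ≤ M)
    [MeasurableSpace (archLocal L 3 (Matrix.diagonal α) w)] [BorelSpace (archLocal L 3 (Matrix.diagonal α) w)]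
    (ν : Measure (archLocal L 3 (Matrix.diagonal α) w)) [ν.IsHaarMeasure] [ν.IsMulRightInvariant]
    (Θ : Matrix (Fin 3) (Fin 3) ℂ → E) (hΘ : ContDiff ℝ ∞ Θ)
    (hΘc : HasCompactSupport fun k : archLocal L 3 (Matrix.diagonal α) w => Θ ((k : GL (Fin 3) ℂ) : Matrix (Fin 3) (Fin 3) ℂ))
    (ζ : Circle) (τ : Equiv.Perm (Fin 3)) (n : ℕ) :
    ∃ M : ℝ, ∀ θ ∈ {θ : Fin 3 → ℝ | θ (τ 0) < θ (τ 1) ∧ θ (τ 1) < θ (τ 2)} ∩ ball (0 : Fin 3 → ℝ) (1 / 4),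
      ‖iteratedFDeriv ℝ n (fun θ : Fin 3 → ℝ => (rootProduct θ : ℝ) •
        ∫ g, Θ (((g * ⟨circleDiagonal 3 (fun k => ζ * Circle.exp (θ k)), circleDiagonal_mem_archLocal_diagonal L 3 α w _⟩ * g⁻¹ : archLocal L 3 (Matrix.diagonal α) w) : GL (Fin 3) ℂ) : Matrix (Fin 3) (Fin 3) ℂ) ∂ν) θ‖ ≤ M := by
  -- topology and Borel structure on the relabelled frame `G_w(α ∘ σ′)`
  haveI : LocallyCompactSpace (archLocal L 3 (Matrix.diagonal (α ∘ ⇑σ')) w) := locallyCompactSpace_archLocal L 3 (Matrix.diagonal (α ∘ ⇑σ')) w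
  haveI : SecondCountableTopology (archLocal L 3 (Matrix.diagonal (α ∘ ⇑σ')) w) := secondCountableTopology_archLocal L 3 (Matrix.diagonal (α ∘ ⇑σ')) w
  letI : MeasurableSpace (archLocal L 3 (Matrix.diagonal (α ∘ ⇑σ')) w) := borel _
  haveI : BorelSpace (archLocal L 3 (Matrix.diagonal (α ∘ ⇑σ')) w) := ⟨rfl⟩
  -- the pulled-back Haar measure `(e_σ′⁻¹)_* ν`
  haveI hH := (ContinuousMulEquiv.restrictSubgroup (GLn.conjEquiv (Matrix.GeneralLinearGroup.mkOfDetNeZero _ (det_monomial_one_ne_zero 3 σ')))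
        (archLocal L 3 (Matrix.diagonal (α ∘ ⇑σ')) w) (archLocal L 3 (Matrix.diagonal α) w) (mem_archLocal_comp_perm_iff_conj_mem L 3 α w σ')).symm.isHaarMeasure_map ν
  haveI hR := isMulRightInvariant_map_relabel_symm L 3 α w σ' ν
  -- the bound at the relabelled frame for the transported data and the chamber `σ′⁻¹ τ`
  obtain ⟨M, hM⟩ := h
    (ν.map (ContinuousMulEquiv.restrictSubgroup (GLn.conjEquiv (Matrix.GeneralLinearGroup.mkOfDetNeZero _ (det_monomial_one_ne_zero 3 σ')))
        (archLocal L 3 (Matrix.diagonal (α ∘ ⇑σ')) w) (archLocal L 3 (Matrix.diagonal α) w) (mem_archLocal_comp_perm_iff_conj_mem L 3 α w σ')).symm)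
    (fun A : Matrix (Fin 3) (Fin 3) ℂ => Θ ((monomial σ' fun _ : Fin 3 => (1 : ℂ)) * A *
      (((Matrix.GeneralLinearGroup.mkOfDetNeZero _ (det_monomial_one_ne_zero 3 σ'))⁻¹ : GL (Fin 3) ℂ) : Matrix (Fin 3) (Fin 3) ℂ)))
    (contDiff_comp_monomial_conj 3 σ' Θ hΘ) (hasCompactSupport_comp_relabel L 3 α w σ' Θ hΘc) ζ (σ'⁻¹ * τ) n
  -- abbreviate the relabelled torus function
  set F' : (Fin 3 → ℝ) → E := fun θ : Fin 3 → ℝ => (rootProduct θ : ℝ) •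
    ∫ g', (fun A : Matrix (Fin 3) (Fin 3) ℂ => Θ ((monomial σ' fun _ : Fin 3 => (1 : ℂ)) * A *
      (((Matrix.GeneralLinearGroup.mkOfDetNeZero _ (det_monomial_one_ne_zero 3 σ'))⁻¹ : GL (Fin 3) ℂ) : Matrix (Fin 3) (Fin 3) ℂ)))
      (((g' * ⟨circleDiagonal 3 (fun k => ζ * Circle.exp (θ k)), circleDiagonal_mem_archLocal_diagonal L 3 (α ∘ ⇑σ') w _⟩ * g'⁻¹ :
        archLocal L 3 (Matrix.diagonal (α ∘ ⇑σ')) w) : GL (Fin 3) ℂ) : Matrix (Fin 3) (Fin 3) ℂ)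
    ∂(ν.map (ContinuousMulEquiv.restrictSubgroup (GLn.conjEquiv (Matrix.GeneralLinearGroup.mkOfDetNeZero _ (det_monomial_one_ne_zero 3 σ')))
        (archLocal L 3 (Matrix.diagonal (α ∘ ⇑σ')) w) (archLocal L 3 (Matrix.diagonal α) w) (mem_archLocal_comp_perm_iff_conj_mem L 3 α w σ')).symm) with hF'
  obtain ⟨Λ, hΛ⟩ := exists_linearIsometryEquiv_comp_perm σ'
  -- the orbital factor at `α` read at the relabelled frame
  have hback : ∀ θ : Fin 3 → ℝ,
      (∫ g : archLocal L 3 (Matrix.diagonal α) w,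
        Θ ((((g * ⟨circleDiagonal 3 (fun k => ζ * Circle.exp (θ k)), circleDiagonal_mem_archLocal_diagonal L 3 α w _⟩ * g⁻¹ : archLocal L 3 (Matrix.diagonal α) w) :
          GL (Fin 3) ℂ) : Matrix (Fin 3) (Fin 3) ℂ)) ∂ν) =
      ∫ g' : archLocal L 3 (Matrix.diagonal (α ∘ ⇑σ')) w,
        (fun A : Matrix (Fin 3) (Fin 3) ℂ => Θ ((monomial σ' fun _ : Fin 3 => (1 : ℂ)) * A *
          (((Matrix.GeneralLinearGroup.mkOfDetNeZero _ (det_monomial_one_ne_zero 3 σ'))⁻¹ : GL (Fin 3) ℂ) : Matrix (Fin 3) (Fin 3) ℂ)))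
          (((g' * ⟨circleDiagonal 3 (fun k => ζ * Circle.exp ((θ ∘ ⇑σ') k)), circleDiagonal_mem_archLocal_diagonal L 3 (α ∘ ⇑σ') w _⟩ * g'⁻¹ :
            archLocal L 3 (Matrix.diagonal (α ∘ ⇑σ')) w) : GL (Fin 3) ℂ) : Matrix (Fin 3) (Fin 3) ℂ)
        ∂(ν.map (ContinuousMulEquiv.restrictSubgroup (GLn.conjEquiv (Matrix.GeneralLinearGroup.mkOfDetNeZero _ (det_monomial_one_ne_zero 3 σ')))
          (archLocal L 3 (Matrix.diagonal (α ∘ ⇑σ')) w) (archLocal L 3 (Matrix.diagonal α) w) (mem_archLocal_comp_perm_iff_conj_mem L 3 α w σ')).symm) := by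
    intro θ
    rw [← integral_comp_conj_circleDiagonal_comp_perm_eq_integral_ambient L 3 α w σ' ν Θ (fun k => ζ * Circle.exp ((θ ∘ ⇑σ') k))]
    have hr : (⟨circleDiagonal 3 (fun i => (fun k => ζ * Circle.exp ((θ ∘ ⇑σ') k)) (σ'.symm i)),
          circleDiagonal_mem_archLocal_diagonal L 3 α w (fun i => (fun k => ζ * Circle.exp ((θ ∘ ⇑σ') k)) (σ'.symm i))⟩ : archLocal L 3 (Matrix.diagonal α) w) =
        ⟨circleDiagonal 3 (fun k => ζ * Circle.exp (θ k)), circleDiagonal_mem_archLocal_diagonal L 3 α w _⟩ := by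
      apply Subtype.ext
      simp only [Function.comp_apply, Equiv.apply_symm_apply]
    rw [hr]
  -- `F^α = sign(σ′) • (F′ ∘ Λ)`
  have hfun : (fun θ : Fin 3 → ℝ => (rootProduct θ : ℝ) •
        ∫ g, Θ (((g * ⟨circleDiagonal 3 (fun k => ζ * Circle.exp (θ k)), circleDiagonal_mem_archLocal_diagonal L 3 α w _⟩ * g⁻¹ : archLocal L 3 (Matrix.diagonal α) w) : GL (Fin 3) ℂ) : Matrix (Fin 3) (Fin 3) ℂ) ∂ν) =
      fun θ => (((Equiv.Perm.sign σ' : ℤ) : ℝ)) • (F' ∘ Λ) θ := by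
    funext θ
    rw [hback θ, Function.comp_apply, hΛ θ, hF']
    dsimp only
    rw [smul_smul, rootProduct_comp_perm, ← mul_assoc, ← Int.cast_mul, ← Units.val_mul, Int.units_mul_self, Units.val_one, Int.cast_one, one_mul]
  refine ⟨M, fun θ hθ => ?_⟩
  have hθ' : Λ θ ∈ {θ : Fin 3 → ℝ | θ ((σ'⁻¹ * τ) 0) < θ ((σ'⁻¹ * τ) 1) ∧ θ ((σ'⁻¹ * τ) 1) < θ ((σ'⁻¹ * τ) 2)} ∩ ball (0 : Fin 3 → ℝ) (1 / 4) := by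
    refine ⟨?_, ?_⟩
    · rw [hΛ θ]
      simpa only [Set.mem_setOf_eq, Function.comp_apply, Equiv.Perm.mul_apply, Equiv.Perm.coe_inv, Equiv.apply_symm_apply] using hθ.1
    · rw [mem_ball_zero_iff, Λ.norm_map]
      exact mem_ball_zero_iff.1 hθ.2
  rw [hfun]
  rcases Int.units_eq_one_or (Equiv.Perm.sign σ') with hs | hs
  · rw [hs, Units.val_one, Int.cast_one]
    simp only [one_smul]
    rw [show (fun θ => (F' ∘ ⇑Λ) θ) = F' ∘ ⇑Λ from rfl, Λ.norm_iteratedFDeriv_comp_right F' θ n]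
    exact hM _ hθ'
  · rw [hs, Units.val_neg, Units.val_one, Int.cast_neg, Int.cast_one]
    simp only [neg_smul, one_smul]
    rw [show (fun θ => -(F' ∘ ⇑Λ) θ) = -(F' ∘ ⇑Λ) from rfl, iteratedFDeriv_neg_apply, norm_neg, Λ.norm_iteratedFDeriv_comp_right F' θ n]
    exact hM _ hθ'

end OfPerm

/-! ## §4 Definite frames: `G_w` compact, `F` is `C^∞` on all of `ℝ³` -/

section Definite

variable (L : Type) [Field L] (α : Fin 3 → L) (w : {w : InfinitePlace L // IsComplex w})
variable {E : Type u} [NormedAddCommGroup E] [NormedSpace ℝ E] [CompleteSpace E]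

/-- **DEFINITE FRAMES**: if `σ_w diag α` is positive or negative definite then `G_w` is compact, `θ ↦ Φ_Θ(ζe^{iθ})` is `C^∞` on `ℝ³` (★ `contDiff_integral_comp_conj_circleDiagonal_angles_of_posDef`),
so is `F = π • Φ_Θ`, and every jet of `F` is bounded on the ball `B(0,¼)` (continuous on the compact closed ball; the support hypothesis is idle here and kept only for the uniform
binder shape of §5). [cite: Rogawski1990, §8.4 p. 126] [cite: PlatonovRapinchuk1994, §3.2 Thm. 3.1] -/
theorem exists_forall_norm_iteratedFDeriv_rootProduct_smul_orbital_le_of_definite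
    (hpos : ((Matrix.diagonal α).map (w.1.embedding : L →+* ℂ)).PosDef ∨ (-((Matrix.diagonal α).map (w.1.embedding : L →+* ℂ))).PosDef)
    [MeasurableSpace (archLocal L 3 (Matrix.diagonal α) w)] [BorelSpace (archLocal L 3 (Matrix.diagonal α) w)]
    (ν : Measure (archLocal L 3 (Matrix.diagonal α) w)) [ν.IsHaarMeasure] [ν.IsMulRightInvariant]
    (Θ : Matrix (Fin 3) (Fin 3) ℂ → E) (hΘ : ContDiff ℝ ∞ Θ)
    (_hΘc : HasCompactSupport fun k : archLocal L 3 (Matrix.diagonal α) w => Θ ((k : GL (Fin 3) ℂ) : Matrix (Fin 3) (Fin 3) ℂ))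
    (ζ : Circle) (σ : Equiv.Perm (Fin 3)) (n : ℕ) :
    ∃ M : ℝ, ∀ θ ∈ {θ : Fin 3 → ℝ | θ (σ 0) < θ (σ 1) ∧ θ (σ 1) < θ (σ 2)} ∩ ball (0 : Fin 3 → ℝ) (1 / 4),
      ‖iteratedFDeriv ℝ n (fun θ : Fin 3 → ℝ => (rootProduct θ : ℝ) •
        ∫ g, Θ (((g * ⟨circleDiagonal 3 (fun k => ζ * Circle.exp (θ k)), circleDiagonal_mem_archLocal_diagonal L 3 α w _⟩ * g⁻¹ : archLocal L 3 (Matrix.diagonal α) w) : GL (Fin 3) ℂ) : Matrix (Fin 3) (Fin 3) ℂ) ∂ν) θ‖ ≤ M := by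
  haveI : CompactSpace (archLocal L 3 (Matrix.diagonal α) w) := compactSpace_archLocal_of_posDef L 3 α w hpos
  have hΦ := contDiff_integral_comp_conj_circleDiagonal_angles_of_posDef L 3 α w hpos ν Θ hΘ (fun _ : Fin 3 => ζ)
  beta_reduce at hΦ
  have hF : ContDiff ℝ ∞ (fun θ : Fin 3 → ℝ => (rootProduct θ : ℝ) •
      ∫ g, Θ (((g * ⟨circleDiagonal 3 (fun k => ζ * Circle.exp (θ k)), circleDiagonal_mem_archLocal_diagonal L 3 α w _⟩ * g⁻¹ : archLocal L 3 (Matrix.diagonal α) w) : GL (Fin 3) ℂ) : Matrix (Fin 3) (Fin 3) ℂ) ∂ν) :=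
    contDiff_rootProduct.smul hΦ
  have hcont : Continuous (iteratedFDeriv ℝ n (fun θ : Fin 3 → ℝ => (rootProduct θ : ℝ) •
      ∫ g, Θ (((g * ⟨circleDiagonal 3 (fun k => ζ * Circle.exp (θ k)), circleDiagonal_mem_archLocal_diagonal L 3 α w _⟩ * g⁻¹ : archLocal L 3 (Matrix.diagonal α) w) : GL (Fin 3) ℂ) : Matrix (Fin 3) (Fin 3) ℂ) ∂ν)) :=
    hF.continuous_iteratedFDeriv (by exact_mod_cast le_top)
  obtain ⟨M, hM⟩ := (isCompact_closedBall (0 : Fin 3 → ℝ) (1 / 4)).exists_bound_of_continuousOn hcont.continuousOn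
  exact ⟨M, fun θ hθ => hM θ (ball_subset_closedBall hθ.2)⟩

end Definite

/-! ## §5 THE HEAD: Harish-Chandra's chamber jet bound at EVERY frame; smoothness on the chambers -/

section Head

variable (L : Type) [Field L] (α : Fin 3 → L) (w : {w : InfinitePlace L // IsComplex w})
variable {E : Type u} [NormedAddCommGroup E] [NormedSpace ℝ E] [CompleteSpace E]

/-- **HARISH-CHANDRA'S JET BOUNDS AT A CENTRAL POINT — EVERY FRAME, BANACH-VALUED.**  For `G_w = U(σ_w diag α)(ℂ)` with frame guards `α_i ≠ 0`, `im σ_wα_i = 0` (ANY of the eight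
sign patterns), a right-invariant Haar `ν`, a complete real normed space `E`, `Θ ∈ C^∞(M₃(ℂ); E)` with `k ↦ Θ(↑↑k)` compactly supported on `G_w`, a centre `ζ ∈ S¹`, a chamber `σ` and an
order `n`: the `π`-normalised torus orbital integral `F(θ) = (θ₀−θ₁)(θ₀−θ₂)(θ₁−θ₂) • ∫_{G_w} Θ(↑↑(g·diag(ζe^{iθ_k})·g⁻¹)) dν` has `‖DⁿF‖ ≤ M` on `C_σ ∩ B(0,¼)` — the local boundedness of
every jet of the normalised invariant integral at the central point `ζ·1` of the compact Cartan subgroup (Bouaziz's (I₁) at a compact-scalar corner, one place).  e-pattern frames §1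
(★ (d2) Warner Thm. 8.4.3.1 on `𝔲(2,1)`), the other indefinite patterns by §2–§3, definite frames §4.
[cite: WarnerHASSLG2, Thm. 8.4.3.1; §8.5.1] [cite: HarishChandra1957DiffOps, Thm. 1] [cite: Varadarajan1977, I §3; II §12] [cite: Bouaziz1994IntegralesOrbitales, §3.1 (I₁) p. 579] -/
theorem exists_forall_norm_iteratedFDeriv_rootProduct_smul_orbital_le
    [MeasurableSpace (archLocal L 3 (Matrix.diagonal α) w)] [BorelSpace (archLocal L 3 (Matrix.diagonal α) w)]
    (hα : ∀ i, α i ≠ 0) (hreal : ∀ i, (w.1.embedding (α i)).im = 0)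
    (ν : Measure (archLocal L 3 (Matrix.diagonal α) w)) [ν.IsHaarMeasure] [ν.IsMulRightInvariant]
    (Θ : Matrix (Fin 3) (Fin 3) ℂ → E) (hΘ : ContDiff ℝ ∞ Θ)
    (hΘc : HasCompactSupport fun k : archLocal L 3 (Matrix.diagonal α) w => Θ ((k : GL (Fin 3) ℂ) : Matrix (Fin 3) (Fin 3) ℂ))
    (ζ : Circle) (σ : Equiv.Perm (Fin 3)) (n : ℕ) :
    ∃ M : ℝ, ∀ θ ∈ {θ : Fin 3 → ℝ | θ (σ 0) < θ (σ 1) ∧ θ (σ 1) < θ (σ 2)} ∩ ball (0 : Fin 3 → ℝ) (1 / 4),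
      ‖iteratedFDeriv ℝ n (fun θ : Fin 3 → ℝ => (rootProduct θ : ℝ) •
        ∫ g, Θ (((g * ⟨circleDiagonal 3 (fun k => ζ * Circle.exp (θ k)), circleDiagonal_mem_archLocal_diagonal L 3 α w _⟩ * g⁻¹ : archLocal L 3 (Matrix.diagonal α) w) : GL (Fin 3) ℂ) : Matrix (Fin 3) (Fin 3) ℂ) ∂ν) θ‖ ≤ M := by
  have hne : ∀ i, (w.1.embedding (α i)).re ≠ 0 := re_embedding_ne_zero L 3 α w hα hreal
  obtain ⟨a0, a1, a2⟩ : Equiv.swap (1 : Fin 3) 2 0 = 0 ∧ Equiv.swap (1 : Fin 3) 2 1 = 2 ∧ Equiv.swap (1 : Fin 3) 2 2 = 1 := by decide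
  obtain ⟨b0, b1, b2⟩ : Equiv.swap (0 : Fin 3) 2 0 = 2 ∧ Equiv.swap (0 : Fin 3) 2 1 = 1 ∧ Equiv.swap (0 : Fin 3) 2 2 = 0 := by decide
  -- the frames `−β` (for any `β` with `σ_wβ_i` real): hypotheses of §2
  have hrealn : ∀ β : Fin 3 → L, (∀ i, (w.1.embedding (β i)).im = 0) → ∀ i, (w.1.embedding ((fun j => -β j) i)).im = 0 := fun β hβ i => by
    show (w.1.embedding (-β i)).im = 0
    rw [map_neg, Complex.neg_im, hβ i, neg_zero]
  have hoppn : ∀ β : Fin 3 → L, (∀ i, (w.1.embedding (β i)).re ≠ 0) → ∀ i, (w.1.embedding (β i)).re * (w.1.embedding ((fun j => -β j) i)).re < 0 := fun β hβ i => by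
    show (w.1.embedding (β i)).re * (w.1.embedding (-β i)).re < 0
    rw [map_neg, Complex.neg_re]
    nlinarith [sq_pos_of_ne_zero (hβ i)]
  have hren : ∀ i, (w.1.embedding ((fun j => -α j) i)).re = -(w.1.embedding (α i)).re := fun i => by
    show (w.1.embedding (-α i)).re = _
    rw [map_neg, Complex.neg_re]
  rcases (hne 0).lt_or_gt with h0 | h0 <;> rcases (hne 1).lt_or_gt with h1 | h1 <;> rcases (hne 2).lt_or_gt with h2 | h2
  · -- (−,−,−): negative definite
    refine exists_forall_norm_iteratedFDeriv_rootProduct_smul_orbital_le_of_definite L α w (Or.inr ?_) ν Θ hΘ hΘc ζ σ n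
    rw [Matrix.diagonal_map (map_zero _), Matrix.diagonal_neg, Matrix.posDef_diagonal_iff]
    intro i
    refine complex_pos_of_re_pos_of_im_eq_zero _ ?_ ?_
    · rw [Complex.neg_re, neg_pos]
      exact match i with | 0 => h0 | 1 => h1 | 2 => h2
    · rw [Complex.neg_im, hreal i, neg_zero]
  · -- (−,−,+): `−α` has the e-pattern
    exact forall_norm_iteratedFDeriv_rootProduct_smul_orbital_le_of_oppositeSigns L α w L (fun j => -α j) w hreal (hrealn α hreal) (hoppn α hne)
      (exists_forall_norm_iteratedFDeriv_rootProduct_smul_orbital_le_of_ppm L (fun j => -α j) w (hrealn α hreal)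
        (by rw [hren]; linarith) (by rw [hren]; linarith) (by rw [hren]; linarith)) ν Θ hΘ hΘc ζ σ n
  · -- (−,+,−): relabel by `swap 1 2` to (−,−,+), then `−α`
    refine forall_norm_iteratedFDeriv_rootProduct_smul_orbital_le_of_perm L α w (Equiv.swap 1 2) ?_ ν Θ hΘ hΘc ζ σ n
    refine forall_norm_iteratedFDeriv_rootProduct_smul_orbital_le_of_oppositeSigns L (α ∘ ⇑(Equiv.swap 1 2)) w L (fun j => -(α ∘ ⇑(Equiv.swap 1 2)) j) w
      (fun i => hreal _) (hrealn _ fun i => hreal _) (hoppn _ fun i => hne _)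
      (exists_forall_norm_iteratedFDeriv_rootProduct_smul_orbital_le_of_ppm L (fun j => -(α ∘ ⇑(Equiv.swap 1 2)) j) w (hrealn _ fun i => hreal _) ?_ ?_ ?_)
    · show 0 < (w.1.embedding (-(α (Equiv.swap (1 : Fin 3) 2 0)))).re
      rw [a0, map_neg, Complex.neg_re]; linarith
    · show 0 < (w.1.embedding (-(α (Equiv.swap (1 : Fin 3) 2 1)))).re
      rw [a1, map_neg, Complex.neg_re]; linarith
    · show (w.1.embedding (-(α (Equiv.swap (1 : Fin 3) 2 2)))).re < 0
      rw [a2, map_neg, Complex.neg_re]; linarith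
  · -- (−,+,+): relabel by `swap 0 2` to (+,+,−)
    refine forall_norm_iteratedFDeriv_rootProduct_smul_orbital_le_of_perm L α w (Equiv.swap 0 2) ?_ ν Θ hΘ hΘc ζ σ n
    refine exists_forall_norm_iteratedFDeriv_rootProduct_smul_orbital_le_of_ppm L (α ∘ ⇑(Equiv.swap 0 2)) w (fun i => hreal _) ?_ ?_ ?_
    · show 0 < (w.1.embedding (α (Equiv.swap (0 : Fin 3) 2 0))).re
      rw [b0]; exact h2
    · show 0 < (w.1.embedding (α (Equiv.swap (0 : Fin 3) 2 1))).re
      rw [b1]; exact h1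
    · show (w.1.embedding (α (Equiv.swap (0 : Fin 3) 2 2))).re < 0
      rw [b2]; exact h0
  · -- (+,−,−): relabel by `swap 0 2` to (−,−,+), then `−α`
    refine forall_norm_iteratedFDeriv_rootProduct_smul_orbital_le_of_perm L α w (Equiv.swap 0 2) ?_ ν Θ hΘ hΘc ζ σ n
    refine forall_norm_iteratedFDeriv_rootProduct_smul_orbital_le_of_oppositeSigns L (α ∘ ⇑(Equiv.swap 0 2)) w L (fun j => -(α ∘ ⇑(Equiv.swap 0 2)) j) w
      (fun i => hreal _) (hrealn _ fun i => hreal _) (hoppn _ fun i => hne _)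
      (exists_forall_norm_iteratedFDeriv_rootProduct_smul_orbital_le_of_ppm L (fun j => -(α ∘ ⇑(Equiv.swap 0 2)) j) w (hrealn _ fun i => hreal _) ?_ ?_ ?_)
    · show 0 < (w.1.embedding (-(α (Equiv.swap (0 : Fin 3) 2 0)))).re
      rw [b0, map_neg, Complex.neg_re]; linarith
    · show 0 < (w.1.embedding (-(α (Equiv.swap (0 : Fin 3) 2 1)))).re
      rw [b1, map_neg, Complex.neg_re]; linarith
    · show (w.1.embedding (-(α (Equiv.swap (0 : Fin 3) 2 2)))).re < 0
      rw [b2, map_neg, Complex.neg_re]; linarith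
  · -- (+,−,+): relabel by `swap 1 2` to (+,+,−)
    refine forall_norm_iteratedFDeriv_rootProduct_smul_orbital_le_of_perm L α w (Equiv.swap 1 2) ?_ ν Θ hΘ hΘc ζ σ n
    refine exists_forall_norm_iteratedFDeriv_rootProduct_smul_orbital_le_of_ppm L (α ∘ ⇑(Equiv.swap 1 2)) w (fun i => hreal _) ?_ ?_ ?_
    · show 0 < (w.1.embedding (α (Equiv.swap (1 : Fin 3) 2 0))).re
      rw [a0]; exact h0
    · show 0 < (w.1.embedding (α (Equiv.swap (1 : Fin 3) 2 1))).re
      rw [a1]; exact h2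
    · show (w.1.embedding (α (Equiv.swap (1 : Fin 3) 2 2))).re < 0
      rw [a2]; exact h1
  · -- (+,+,−): the e-pattern itself
    exact exists_forall_norm_iteratedFDeriv_rootProduct_smul_orbital_le_of_ppm L α w hreal h0 h1 h2 ν Θ hΘ hΘc ζ σ n
  · -- (+,+,+): positive definite
    refine exists_forall_norm_iteratedFDeriv_rootProduct_smul_orbital_le_of_definite L α w (Or.inl ?_) ν Θ hΘ hΘc ζ σ n
    rw [Matrix.diagonal_map (map_zero _), Matrix.posDef_diagonal_iff]
    intro i
    refine complex_pos_of_re_pos_of_im_eq_zero _ ?_ ?_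
    · exact match i with | 0 => h0 | 1 => h1 | 2 => h2
    · exact hreal i

/-- **`F` IS `C^∞` ON EVERY CHAMBER NEAR THE CORNER, AT EVERY FRAME** (radius `½`): the chart point `ζe^{iθ}` is regular there (pairwise distinct circle entries), so ★
`contDiffOn_integral_comp_conj_circleDiagonal_angles_of_blocks` (singleton blocks, any signature, E-valued) and ★ `contDiff_rootProduct` apply. [cite: Rogawski1990, §8.4 p. 126] [cite: WarnerHASSLG2, §8.5.1] -/
theorem contDiffOn_rootProduct_smul_orbital_chamber_ball
    [MeasurableSpace (archLocal L 3 (Matrix.diagonal α) w)] [BorelSpace (archLocal L 3 (Matrix.diagonal α) w)]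
    (hα : ∀ i, α i ≠ 0) (hreal : ∀ i, (w.1.embedding (α i)).im = 0)
    (ν : Measure (archLocal L 3 (Matrix.diagonal α) w)) [IsFiniteMeasureOnCompacts ν]
    (Θ : Matrix (Fin 3) (Fin 3) ℂ → E) (hΘ : ContDiff ℝ ∞ Θ)
    (hΘc : HasCompactSupport fun k : archLocal L 3 (Matrix.diagonal α) w => Θ ((k : GL (Fin 3) ℂ) : Matrix (Fin 3) (Fin 3) ℂ))
    (ζ : Circle) (σ : Equiv.Perm (Fin 3)) :
    ContDiffOn ℝ ∞ (fun θ : Fin 3 → ℝ => (rootProduct θ : ℝ) •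
        ∫ g, Θ (((g * ⟨circleDiagonal 3 (fun k => ζ * Circle.exp (θ k)), circleDiagonal_mem_archLocal_diagonal L 3 α w _⟩ * g⁻¹ : archLocal L 3 (Matrix.diagonal α) w) : GL (Fin 3) ℂ) : Matrix (Fin 3) (Fin 3) ℂ) ∂ν)
      ({θ : Fin 3 → ℝ | θ (σ 0) < θ (σ 1) ∧ θ (σ 1) < θ (σ 2)} ∩ ball (0 : Fin 3 → ℝ) (1 / 2)) := by
  have h := contDiffOn_integral_comp_conj_circleDiagonal_angles_of_blocks L 3 α w hα hreal (b := fun i : Fin 3 => i)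
    (fun i j hij hb => absurd hb hij) ν Θ hΘ hΘc (fun _ : Fin 3 => ζ)
  refine contDiff_rootProduct.contDiffOn.smul (h.mono ?_)
  intro θ hθ i j hij
  exact angleChart_ne_of_mem_chamber_ball ζ σ hθ i j hij

end Head

/-! ## §6 Rider: ONE constant for every `Θ = ℓ ∘ G`, scaled by `‖ℓ‖` — the seminorm form (twin of ★ (ELL-∞-UNIF) §4) -/

section Clm

variable (L : Type) [Field L] (α : Fin 3 → L) (w : {w : InfinitePlace L // IsComplex w})
variable {E : Type u} [NormedAddCommGroup E] [NormedSpace ℝ E] [CompleteSpace E]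
variable {E' : Type*} [NormedAddCommGroup E'] [NormedSpace ℝ E'] [CompleteSpace E']

/-- On a chamber piece `C_σ ∩ B(0,¼)` the `π`-normalised torus orbital integral COMMUTES WITH CONTINUOUS LINEAR MAPS: `F_{ℓ∘G}(θ) = ℓ (F_G θ)` (the chart point is regular there, so the integrand
is continuous with compact support ★ `integrable_comp_conj_circleDiagonal`, and Bochner integrals commute with `ℓ`). [cite: Rogawski1990, §8.3 p. 122; §8.4 p. 126] -/
theorem rootProduct_smul_orbital_comp_clm_eq_of_mem_chamber_ball
    [MeasurableSpace (archLocal L 3 (Matrix.diagonal α) w)] [BorelSpace (archLocal L 3 (Matrix.diagonal α) w)]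
    (hα : ∀ i, α i ≠ 0) (ν : Measure (archLocal L 3 (Matrix.diagonal α) w)) [IsFiniteMeasureOnCompacts ν]
    (G : Matrix (Fin 3) (Fin 3) ℂ → E') (hG : Continuous G)
    (hGc : HasCompactSupport fun k : archLocal L 3 (Matrix.diagonal α) w => G ((k : GL (Fin 3) ℂ) : Matrix (Fin 3) (Fin 3) ℂ))
    (ℓ : E' →L[ℝ] E) (ζ : Circle) (σ : Equiv.Perm (Fin 3)) {θ : Fin 3 → ℝ}
    (hθ : θ ∈ {θ : Fin 3 → ℝ | θ (σ 0) < θ (σ 1) ∧ θ (σ 1) < θ (σ 2)} ∩ ball (0 : Fin 3 → ℝ) (1 / 2)) :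
    ((rootProduct θ : ℝ) • ∫ g, ℓ (G (((g * ⟨circleDiagonal 3 (fun k => ζ * Circle.exp (θ k)), circleDiagonal_mem_archLocal_diagonal L 3 α w _⟩ * g⁻¹ : archLocal L 3 (Matrix.diagonal α) w) : GL (Fin 3) ℂ) : Matrix (Fin 3) (Fin 3) ℂ)) ∂ν) =
      ℓ ((rootProduct θ : ℝ) • ∫ g, G (((g * ⟨circleDiagonal 3 (fun k => ζ * Circle.exp (θ k)), circleDiagonal_mem_archLocal_diagonal L 3 α w _⟩ * g⁻¹ : archLocal L 3 (Matrix.diagonal α) w) : GL (Fin 3) ℂ) : Matrix (Fin 3) (Fin 3) ℂ) ∂ν) := by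
  have hz : Function.Injective (fun k : Fin 3 => ζ * Circle.exp (θ k)) := fun i j hij => by
    by_contra hne
    exact angleChart_ne_of_mem_chamber_ball ζ σ hθ i j hne hij
  have hint := integrable_comp_conj_circleDiagonal L 3 α w hα ν hz
    (fun k : archLocal L 3 (Matrix.diagonal α) w => G ((k : GL (Fin 3) ℂ) : Matrix (Fin 3) (Fin 3) ℂ))
    (hG.comp (Units.continuous_val.comp continuous_subtype_val)) hGc
  rw [ℓ.map_smul, ← ℓ.integral_comp_comm hint]

/-- **THE CLM-UNIFORM (SEMINORM) FORM OF HARISH-CHANDRA'S BOUND**: for `G ∈ C^∞(M₃(ℂ); E′)` compactly supported on `G_w`, a centre `ζ`, a chamber `σ` and an order `n`, ONE constant `M` with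
`‖Dⁿ F_{ℓ∘G}(θ)‖ ≤ ‖ℓ‖ · M` on `C_σ ∩ B(0,¼)` SIMULTANEOUSLY for all `ℓ : E′ →L[ℝ] E` — uniformity over every family of test functions that is the image of one `G` under CLMs (e.g. a
compact-parameter family curried into `E′ = C(K, E)`, `ℓ = ev_k`; the shape the (I₁) parametric ∕ `ℓ^∞` readers consume).  `F_{ℓ∘G} = ℓ ∘ F_G` near `θ`, `Dⁿ(ℓ ∘ F_G) = ℓ ∘ DⁿF_G` on the open
chamber piece where `F_G` is `C^∞` (§5), `‖ℓ ∘ m‖ ≤ ‖ℓ‖‖m‖`. [cite: WarnerHASSLG2, Thm. 8.4.3.1] [cite: Varadarajan1977, I §3] [cite: Bouaziz1994IntegralesOrbitales, §3.1 (I₁) p. 579] -/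
theorem exists_forall_norm_iteratedFDeriv_rootProduct_smul_orbital_comp_clm_le
    [MeasurableSpace (archLocal L 3 (Matrix.diagonal α) w)] [BorelSpace (archLocal L 3 (Matrix.diagonal α) w)]
    (hα : ∀ i, α i ≠ 0) (hreal : ∀ i, (w.1.embedding (α i)).im = 0)
    (ν : Measure (archLocal L 3 (Matrix.diagonal α) w)) [ν.IsHaarMeasure] [ν.IsMulRightInvariant]
    (G : Matrix (Fin 3) (Fin 3) ℂ → E') (hG : ContDiff ℝ ∞ G)
    (hGc : HasCompactSupport fun k : archLocal L 3 (Matrix.diagonal α) w => G ((k : GL (Fin 3) ℂ) : Matrix (Fin 3) (Fin 3) ℂ))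
    (ζ : Circle) (σ : Equiv.Perm (Fin 3)) (n : ℕ) :
    ∃ M : ℝ, ∀ θ ∈ {θ : Fin 3 → ℝ | θ (σ 0) < θ (σ 1) ∧ θ (σ 1) < θ (σ 2)} ∩ ball (0 : Fin 3 → ℝ) (1 / 4), ∀ ℓ : E' →L[ℝ] E,
      ‖iteratedFDeriv ℝ n (fun θ : Fin 3 → ℝ => (rootProduct θ : ℝ) •
        ∫ g, ℓ (G (((g * ⟨circleDiagonal 3 (fun k => ζ * Circle.exp (θ k)), circleDiagonal_mem_archLocal_diagonal L 3 α w _⟩ * g⁻¹ : archLocal L 3 (Matrix.diagonal α) w) : GL (Fin 3) ℂ) : Matrix (Fin 3) (Fin 3) ℂ)) ∂ν) θ‖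
        ≤ ‖ℓ‖ * M := by
  obtain ⟨M, hM⟩ := exists_forall_norm_iteratedFDeriv_rootProduct_smul_orbital_le L α w hα hreal ν G hG hGc ζ σ n
  have hsmooth := contDiffOn_rootProduct_smul_orbital_chamber_ball L α w hα hreal ν G hG hGc ζ σ
  -- the open chamber piece
  set S : Set (Fin 3 → ℝ) := {θ : Fin 3 → ℝ | θ (σ 0) < θ (σ 1) ∧ θ (σ 1) < θ (σ 2)} ∩ ball (0 : Fin 3 → ℝ) (1 / 4) with hSdef
  have hS : IsOpen S := (isOpen_chamber σ).inter isOpen_ball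
  have hSsub : S ⊆ {θ : Fin 3 → ℝ | θ (σ 0) < θ (σ 1) ∧ θ (σ 1) < θ (σ 2)} ∩ ball (0 : Fin 3 → ℝ) (1 / 2) :=
    fun θ hθ => ⟨hθ.1, ball_subset_ball (by norm_num) hθ.2⟩
  -- abbreviate `F_G`
  set F : (Fin 3 → ℝ) → E' := fun θ : Fin 3 → ℝ => (rootProduct θ : ℝ) •
    ∫ g, G (((g * ⟨circleDiagonal 3 (fun k => ζ * Circle.exp (θ k)), circleDiagonal_mem_archLocal_diagonal L 3 α w _⟩ * g⁻¹ : archLocal L 3 (Matrix.diagonal α) w) : GL (Fin 3) ℂ) : Matrix (Fin 3) (Fin 3) ℂ) ∂ν with hFdef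
  refine ⟨M, fun θ hθ ℓ => ?_⟩
  -- `F_{ℓ∘G} = ℓ ∘ F_G` near `θ`
  have hEq : (fun θ : Fin 3 → ℝ => (rootProduct θ : ℝ) •
        ∫ g, ℓ (G (((g * ⟨circleDiagonal 3 (fun k => ζ * Circle.exp (θ k)), circleDiagonal_mem_archLocal_diagonal L 3 α w _⟩ * g⁻¹ : archLocal L 3 (Matrix.diagonal α) w) : GL (Fin 3) ℂ) : Matrix (Fin 3) (Fin 3) ℂ)) ∂ν)
      =ᶠ[𝓝 θ] (⇑ℓ ∘ F) := by
    filter_upwards [hS.mem_nhds hθ] with θ' hθ'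
    rw [Function.comp_apply, hFdef]
    exact rootProduct_smul_orbital_comp_clm_eq_of_mem_chamber_ball L α w hα ν G hG.continuous hGc ℓ ζ σ (hSsub hθ')
  rw [(hEq.iteratedFDeriv ℝ n).self_of_nhds, ← iteratedFDerivWithin_of_isOpen n hS hθ,
    ℓ.iteratedFDerivWithin_comp_left ((hsmooth.mono hSsub) θ hθ) hS.uniqueDiffOn hθ (by exact_mod_cast le_top),
    iteratedFDerivWithin_of_isOpen n hS hθ]
  exact (ℓ.norm_compContinuousMultilinearMap_le _).trans (mul_le_mul_of_nonneg_left (hM θ hθ) (norm_nonneg _))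

end Clm

/-! ## §7 Rider: the bound UNIFORM IN THE CENTRE `ζ ∈ S¹` (★ (CURRY-∞): the circle family `Θ(ζ • ·)` is ONE `C^∞` map into `S¹ →ᵇ E`, read through `ev_ζ` by §6) -/

section Centre

variable (L : Type) [Field L] (α : Fin 3 → L) (w : {w : InfinitePlace L // IsComplex w})
variable {E : Type u} [NormedAddCommGroup E] [NormedSpace ℝ E] [CompleteSpace E]

/-- `diag(ζ z) = ζ • diag z` on underlying matrices. [cite: Rogawski1990, §8.2 p. 122] -/
theorem coe_circleDiagonal_const_mul (ζ : Circle) (z : Fin 3 → Circle) :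
    ((circleDiagonal 3 (fun k => ζ * z k) : GL (Fin 3) ℂ) : Matrix (Fin 3) (Fin 3) ℂ) = (ζ : ℂ) • ((circleDiagonal 3 z : GL (Fin 3) ℂ) : Matrix (Fin 3) (Fin 3) ℂ) := by
  rw [coe_circleDiagonal, coe_circleDiagonal, ← Matrix.diagonal_smul]
  congr 1

/-- The central element `diag(ζ,ζ,ζ)` acts on underlying matrices by the scalar `ζ`: `↑↑(diag(ζ·1) · k) = ζ • ↑↑k`. [cite: Rogawski1990, §8.2 p. 122] -/
theorem coe_circleDiagonal_const_mul_eq_smul (ζ : Circle) (k : archLocal L 3 (Matrix.diagonal α) w) :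
    ((((⟨circleDiagonal 3 (fun _ : Fin 3 => ζ), circleDiagonal_mem_archLocal_diagonal L 3 α w _⟩ : archLocal L 3 (Matrix.diagonal α) w) * k :
        archLocal L 3 (Matrix.diagonal α) w) : GL (Fin 3) ℂ) : Matrix (Fin 3) (Fin 3) ℂ) = (ζ : ℂ) • ((k : GL (Fin 3) ℂ) : Matrix (Fin 3) (Fin 3) ℂ) := by
  rw [Subgroup.coe_mul, Units.val_mul, coe_circleDiagonal, Matrix.smul_eq_diagonal_mul]

/-- The central elements `diag(ζ⁻¹·1) · diag(ζ·1) = 1`. [cite: Rogawski1990, §8.2 p. 122] -/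
theorem circleDiagonal_const_inv_mul_const (ζ : Circle) :
    ((⟨circleDiagonal 3 (fun _ : Fin 3 => ζ⁻¹), circleDiagonal_mem_archLocal_diagonal L 3 α w _⟩ : archLocal L 3 (Matrix.diagonal α) w) *
        (⟨circleDiagonal 3 (fun _ : Fin 3 => ζ), circleDiagonal_mem_archLocal_diagonal L 3 α w _⟩ : archLocal L 3 (Matrix.diagonal α) w)) = 1 := by
  apply Subtype.ext
  show circleDiagonal 3 (fun _ : Fin 3 => ζ⁻¹) * circleDiagonal 3 (fun _ : Fin 3 => ζ) = 1
  rw [← map_mul, ← map_one (circleDiagonal 3)]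
  congr 1
  funext i
  simp

/-- **THE CENTRE ONLY RESCALES THE TORUS POINT**: `↑↑(g · diag(ζe^{iθ}) · g⁻¹) = ζ • ↑↑(g · diag(e^{iθ}) · g⁻¹)` (`diag(ζz) = ζ • diag z` is central). [cite: Rogawski1990, §8.2 p. 122] -/
theorem coe_conj_circleDiagonal_centre_mul (ζ : Circle) (z : Fin 3 → Circle) (g : archLocal L 3 (Matrix.diagonal α) w) :
    (((g * ⟨circleDiagonal 3 (fun k => ζ * z k), circleDiagonal_mem_archLocal_diagonal L 3 α w _⟩ * g⁻¹ : archLocal L 3 (Matrix.diagonal α) w) : GL (Fin 3) ℂ) : Matrix (Fin 3) (Fin 3) ℂ) =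
      (ζ : ℂ) • (((g * ⟨circleDiagonal 3 z, circleDiagonal_mem_archLocal_diagonal L 3 α w _⟩ * g⁻¹ : archLocal L 3 (Matrix.diagonal α) w) : GL (Fin 3) ℂ) : Matrix (Fin 3) (Fin 3) ℂ) := by
  simp only [Subgroup.coe_mul, Subgroup.coe_inv, Units.val_mul, coe_circleDiagonal_const_mul, Matrix.mul_smul, Matrix.smul_mul]

/-- **HARISH-CHANDRA'S BOUND, UNIFORM IN THE CENTRE `ζ ∈ S¹`**: for `Θ ∈ C^∞(M₃(ℂ); E)` compactly supported on `G_w`, a chamber `σ` and an order `n`, ONE constant `M` with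
`‖Dⁿ F_{Θ,ζ}(θ)‖ ≤ M` on `C_σ ∩ B(0,¼)` for EVERY centre `ζ`.  The circle family `ζ ↦ Θ(ζ • ·)` curries to ONE `C^∞` map `G : M₃(ℂ) → (S¹ →ᵇ E)` (★ (CURRY-∞) `contDiff_curry_of_contDiff`),
compactly supported on `G_w` (`S¹·K` is compact), `F_{Θ,ζ} = F_{ev_ζ ∘ G, 1}` (the centre rescales the torus point), and §6 bounds all `ev_ζ ∘ G` at once (`‖ev_ζ‖ ≤ 1`).
[cite: WarnerHASSLG2, Thm. 8.4.3.1] [cite: HormanderALPDO1, §1.1 Thm. 1.1.9] [cite: Bouaziz1994IntegralesOrbitales, §3.1 (I₁) p. 579] -/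
theorem exists_forall_norm_iteratedFDeriv_rootProduct_smul_orbital_le_uniform_centre
    [MeasurableSpace (archLocal L 3 (Matrix.diagonal α) w)] [BorelSpace (archLocal L 3 (Matrix.diagonal α) w)]
    (hα : ∀ i, α i ≠ 0) (hreal : ∀ i, (w.1.embedding (α i)).im = 0)
    (ν : Measure (archLocal L 3 (Matrix.diagonal α) w)) [ν.IsHaarMeasure] [ν.IsMulRightInvariant]
    (Θ : Matrix (Fin 3) (Fin 3) ℂ → E) (hΘ : ContDiff ℝ ∞ Θ)
    (hΘc : HasCompactSupport fun k : archLocal L 3 (Matrix.diagonal α) w => Θ ((k : GL (Fin 3) ℂ) : Matrix (Fin 3) (Fin 3) ℂ))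
    (σ : Equiv.Perm (Fin 3)) (n : ℕ) :
    ∃ M : ℝ, ∀ (ζ : Circle), ∀ θ ∈ {θ : Fin 3 → ℝ | θ (σ 0) < θ (σ 1) ∧ θ (σ 1) < θ (σ 2)} ∩ ball (0 : Fin 3 → ℝ) (1 / 4),
      ‖iteratedFDeriv ℝ n (fun θ : Fin 3 → ℝ => (rootProduct θ : ℝ) •
        ∫ g, Θ (((g * ⟨circleDiagonal 3 (fun k => ζ * Circle.exp (θ k)), circleDiagonal_mem_archLocal_diagonal L 3 α w _⟩ * g⁻¹ : archLocal L 3 (Matrix.diagonal α) w) : GL (Fin 3) ℂ) : Matrix (Fin 3) (Fin 3) ℂ) ∂ν) θ‖ ≤ M := by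
  -- the curried circle family `G X = (ζ ↦ Θ(ζ • X))`
  have hΦ : ContDiff ℝ ∞ (fun q : ℂ × Matrix (Fin 3) (Fin 3) ℂ => Θ (q.1 • q.2)) := hΘ.comp (contDiff_fst.smul contDiff_snd)
  have hι : Continuous (fun z : Circle => (z : ℂ)) := continuous_subtype_val
  have h0 : Continuous (fun q : Circle × Matrix (Fin 3) (Fin 3) ℂ => Θ ((q.1 : ℂ) • q.2)) :=
    hΘ.continuous.comp ((hι.comp continuous_fst).smul continuous_snd)
  obtain ⟨G, hGapply⟩ : ∃ G : Matrix (Fin 3) (Fin 3) ℂ → (Circle →ᵇ E), ∀ X z, G X z = Θ ((z : ℂ) • X) :=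
    ⟨fun X => BoundedContinuousFunction.mkOfCompact ⟨fun z => Θ ((z : ℂ) • X), h0.comp (continuous_id.prodMk continuous_const)⟩, fun _ _ => rfl⟩
  have hG : ∀ X z, G X z = (fun q : ℂ × Matrix (Fin 3) (Fin 3) ℂ => Θ (q.1 • q.2)) ((fun z : Circle => (z : ℂ)) z, X) := fun X z => hGapply X z
  have hGs : ContDiff ℝ ∞ G := Literature.Analysis.Calculus.contDiff_curry_of_contDiff hΦ hι hG
  -- compact support on the group: the image of `S¹ × K` under `(ζ, k) ↦ diag(ζ⁻¹·1) · k`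
  have hK : IsCompact ((fun q : Circle × archLocal L 3 (Matrix.diagonal α) w =>
      (⟨circleDiagonal 3 (fun _ : Fin 3 => q.1⁻¹), circleDiagonal_mem_archLocal_diagonal L 3 α w _⟩ : archLocal L 3 (Matrix.diagonal α) w) * q.2) ''
      (univ ×ˢ tsupport (fun k : archLocal L 3 (Matrix.diagonal α) w => Θ ((k : GL (Fin 3) ℂ) : Matrix (Fin 3) (Fin 3) ℂ)))) := by
    refine (isCompact_univ.prod hΘc).image ?_
    refine Continuous.mul (Continuous.subtype_mk ((continuous_circleDiagonal 3).comp (continuous_pi fun _ => ?_)) _) continuous_snd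
    exact continuous_fst.inv
  have hGc : HasCompactSupport fun k : archLocal L 3 (Matrix.diagonal α) w => G ((k : GL (Fin 3) ℂ) : Matrix (Fin 3) (Fin 3) ℂ) := by
    refine HasCompactSupport.intro hK fun k hk => ?_
    ext ζ
    rw [hGapply, ← coe_circleDiagonal_const_mul_eq_smul L α w ζ k]
    show (fun k : archLocal L 3 (Matrix.diagonal α) w => Θ ((k : GL (Fin 3) ℂ) : Matrix (Fin 3) (Fin 3) ℂ)) _ = (0 : Circle →ᵇ E) ζ
    rw [BoundedContinuousFunction.coe_zero, Pi.zero_apply]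
    refine image_eq_zero_of_notMem_tsupport (f := fun k : archLocal L 3 (Matrix.diagonal α) w => Θ ((k : GL (Fin 3) ℂ) : Matrix (Fin 3) (Fin 3) ℂ)) fun hmem => ?_
    refine hk ⟨(ζ, (⟨circleDiagonal 3 (fun _ : Fin 3 => ζ), circleDiagonal_mem_archLocal_diagonal L 3 α w _⟩ : archLocal L 3 (Matrix.diagonal α) w) * k), ⟨mem_univ _, hmem⟩, ?_⟩
    show (⟨circleDiagonal 3 (fun _ : Fin 3 => ζ⁻¹), _⟩ : archLocal L 3 (Matrix.diagonal α) w) *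
        ((⟨circleDiagonal 3 (fun _ : Fin 3 => ζ), _⟩ : archLocal L 3 (Matrix.diagonal α) w) * k) = k
    rw [← mul_assoc, circleDiagonal_const_inv_mul_const, one_mul]
  -- §6 on `G`
  obtain ⟨M, hM⟩ := exists_forall_norm_iteratedFDeriv_rootProduct_smul_orbital_comp_clm_le (E := E) L α w hα hreal ν G hGs hGc 1 σ n
  refine ⟨max M 0, fun ζ θ hθ => ?_⟩
  have hev : ‖(BoundedContinuousFunction.evalCLM ℝ ζ : (Circle →ᵇ E) →L[ℝ] E)‖ ≤ 1 :=
    ContinuousLinearMap.opNorm_le_bound _ zero_le_one fun f => by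
      simpa only [BoundedContinuousFunction.evalCLM_apply, one_mul] using BoundedContinuousFunction.norm_coe_le_norm f ζ
  -- `F_{Θ,ζ} = F_{ev_ζ ∘ G, 1}`
  have hfun : (fun θ : Fin 3 → ℝ => (rootProduct θ : ℝ) •
        ∫ g, Θ (((g * ⟨circleDiagonal 3 (fun k => ζ * Circle.exp (θ k)), circleDiagonal_mem_archLocal_diagonal L 3 α w _⟩ * g⁻¹ : archLocal L 3 (Matrix.diagonal α) w) : GL (Fin 3) ℂ) : Matrix (Fin 3) (Fin 3) ℂ) ∂ν) =
      fun θ : Fin 3 → ℝ => (rootProduct θ : ℝ) •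
        ∫ g, (BoundedContinuousFunction.evalCLM ℝ ζ : (Circle →ᵇ E) →L[ℝ] E) (G (((g * ⟨circleDiagonal 3 (fun k => 1 * Circle.exp (θ k)), circleDiagonal_mem_archLocal_diagonal L 3 α w _⟩ * g⁻¹ : archLocal L 3 (Matrix.diagonal α) w) : GL (Fin 3) ℂ) : Matrix (Fin 3) (Fin 3) ℂ)) ∂ν := by
    funext θ
    congr 1
    refine integral_congr_ae (Filter.Eventually.of_forall fun g => ?_)
    beta_reduce
    rw [BoundedContinuousFunction.evalCLM_apply, hGapply, ← coe_conj_circleDiagonal_centre_mul L α w ζ]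
    simp only [one_mul]
  rw [hfun]
  exact (hM θ hθ (BoundedContinuousFunction.evalCLM ℝ ζ : (Circle →ᵇ E) →L[ℝ] E)).trans
    ((mul_le_mul_of_nonneg_left (le_max_left M 0) (norm_nonneg _)).trans (mul_le_of_le_one_left (le_max_right M 0) hev))

end Centre

end Literature.NumberTheory.Rogawski1990

end
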